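import Summits.FinalStateConjecture.FinalStateConjecture.Theorems.EIHFluxBalanceInertialRecessionAnsatzSmooth
import Summits.FinalStateConjecture.FinalStateConjecture.Theorems.EIHFluxBalanceInertialRecessionStubFirstOrderVariation
import Summits.FinalStateConjecture.FinalStateConjecture.Theorems.EIHFluxBalanceInertialRecessionStubFirstOrderSliceJet
import Summits.FinalStateConjecture.FinalStateConjecture.Theorems.EIHFluxBalanceInertialRecessionStubFirstOrderAbsorb

/-!
# Route EIHFluxBalance — `InertialRecession` (E′), skeleton r13, stub `stub_firstOrderSlaving` (D),
# part 5: the slice jets of the painted ansatz against its inertial continuation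

Helper file for the crux `stmt-FinalStateConjecture-17403` (E′), stub (D). At a lab event `x` of
the slice `{x⁰ = t}`, the painted summand `z ↦ boostedKerrBilin (Λ(z⁰)) (z⁰, ξ(z⁰)) M a z` and the
summand FROZEN at `t` (its inertial continuation, `boostedKerrBilin_inertialCentre`) have the same
value, first derivatives differing by `dx⁰ ⊗ V(x)` and second derivatives differing by
`v⁰ DV(x) + dx⁰ ⊗ DV(x)(v) + v⁰ dx⁰ ⊗ W`, where `V` is the lab first-variation field of the summand at
time `t` — the pull-back of the rest-frame first variation with the body rates
`A = (d/ds Λ⁻¹) ∘ Λ`, `d = −Λ⁻¹ċ` (`firstOrder_hasDerivAt_boostedKerrBilin_motion'`), i.e. the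
variation field of the momentum-coercivity statement (Bs).

* `firstOrder_contDiffAt_summand₂` — joint smoothness of `(s, z) ↦ boostedKerrBilin (Λ s) (c s) M a z`;
* `firstOrder_fderiv_summand₂_time` — its `s`-derivative is the lab first-variation field;
* `firstOrder_modulatedJet` — jets of `G + (x⁰ − t) V` at slice points (the model fields of (ML));
* `firstOrder_summand_sliceJet` — the slice jets of one painted summand (from `firstOrder_sliceJet`).

Elementary; no definitions, no named facts.
-/

set_option linter.dupNamespace false
set_option maxSynthPendingDepth 3

noncomputable section

open scoped Topology
open Filter Set Function Literature.Geometry.Lorentzian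
  Summit.FinalStateConjecture.FinalStateConjecture.Theorems

namespace Summit.FinalStateConjecture.FinalStateConjecture.Theorems.SublinearIsFree.Slaving

/-! ### Jets of a first-order modulated field `G + (π − t) V` -/

section Modulated

variable {E F : Type*} [NormedAddCommGroup E] [NormedSpace ℝ E] [NormedAddCommGroup F]
  [NormedSpace ℝ F]

/-- **Jets of `z ↦ G z + (π z − t) V z` at a point with `π x = t`.** If `G`, `V` are `C²` at `x`:
same value as `G`, `D = DG + π ⊗ V(x)`, `D²(v) = D²G(v) + π(v) DV(x) + π ⊗ DV(x)(v) + π(v) π ⊗ 0`.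
[folklore] -/
theorem firstOrder_modulatedJet {G V : E → F} {π : E →L[ℝ] ℝ} {x : E} {t : ℝ} (hπ : π x = t)
    (hG : ContDiffAt ℝ 2 G x) (hV : ContDiffAt ℝ 2 V x) :
    (fun z ↦ G z + (π z - t) • V z) x = G x ∧
    fderiv ℝ (fun z ↦ G z + (π z - t) • V z) x = fderiv ℝ G x + π.smulRight (V x) ∧
    ∀ v, fderiv ℝ (fderiv ℝ (fun z ↦ G z + (π z - t) • V z)) x v =
      fderiv ℝ (fderiv ℝ G) x v +
        (π v • fderiv ℝ V x + π.smulRight (fderiv ℝ V x v) + π v • π.smulRight (0 : F)) := by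
  have hGd : ∀ᶠ z in 𝓝 x, DifferentiableAt ℝ G z :=
    (hG.eventually (by simp)).mono fun z hz ↦ hz.differentiableAt (by norm_num)
  have hVd : ∀ᶠ z in 𝓝 x, DifferentiableAt ℝ V z :=
    (hV.eventually (by simp)).mono fun z hz ↦ hz.differentiableAt (by norm_num)
  have hw : ∀ z, HasFDerivAt (fun z ↦ π z - t) π z := fun z ↦ π.hasFDerivAt.sub_const t
  -- first derivative near `x`
  have hD1 : ∀ᶠ z in 𝓝 x, HasFDerivAt (fun z ↦ G z + (π z - t) • V z)
      (fderiv ℝ G z + ((π z - t) • fderiv ℝ V z + π.smulRight (V z))) z := by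
    filter_upwards [hGd, hVd] with z hGz hVz
    exact hGz.hasFDerivAt.add ((hw z).smul hVz.hasFDerivAt)
  have hF1 : fderiv ℝ (fun z ↦ G z + (π z - t) • V z) =ᶠ[𝓝 x]
      fun z ↦ fderiv ℝ G z + ((π z - t) • fderiv ℝ V z + π.smulRight (V z)) :=
    hD1.mono fun z hz ↦ hz.fderiv
  -- second derivative at `x`
  have hG2 : HasFDerivAt (fderiv ℝ G) (fderiv ℝ (fderiv ℝ G) x) x :=
    ((hG.fderiv_right (m := 1) (by norm_num)).differentiableAt one_ne_zero).hasFDerivAt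
  have hV2 : HasFDerivAt (fderiv ℝ V) (fderiv ℝ (fderiv ℝ V) x) x :=
    ((hV.fderiv_right (m := 1) (by norm_num)).differentiableAt one_ne_zero).hasFDerivAt
  have hV1 : HasFDerivAt V (fderiv ℝ V x) x := (hV.differentiableAt (by norm_num)).hasFDerivAt
  have hA : HasFDerivAt (fun z ↦ (π z - t) • fderiv ℝ V z)
      ((π x - t) • fderiv ℝ (fderiv ℝ V) x + π.smulRight (fderiv ℝ V x)) x := (hw x).smul hV2
  have hB : HasFDerivAt (fun z ↦ π.smulRight (V z))
      ((ContinuousLinearMap.smulRightL ℝ E F π).comp (fderiv ℝ V x)) x :=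
    (ContinuousLinearMap.smulRightL ℝ E F π).hasFDerivAt.comp x hV1
  have hD2 := hG2.fun_add (hA.fun_add hB)
  refine ⟨?_, ?_, fun v ↦ ?_⟩
  · simp [hπ]
  · rw [hD1.self_of_nhds.fderiv, hπ, sub_self, zero_smul, zero_add]
  · rw [hF1.fderiv_eq, hD2.fderiv, hπ, sub_self, zero_smul, zero_add]
    ext w
    simp

end Modulated

/-! ### Joint smoothness of a painted summand in (time parameter, point) -/

section Summand

variable {Λ : ℝ → lorentzGroup} {ξ : ℝ → E3} {M a : ℝ}

/-- **Joint smoothness**: `(s, z) ↦ boostedKerrBilin (Λ s) (s, ξ s) M a z` is `Cⁿ` at every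
`(s, z)` whose rest-frame radius is positive, along smooth `Λ`, `ξ` (chain rule with
`Kerr.contDiffAt_bilin`; Kerr–Schild 1965, §3). [cite: KerrSchild1965, §3] -/
theorem firstOrder_contDiffAt_summand₂
    (hΛ : ContDiff ℝ ((⊤ : ℕ∞) : WithTop ℕ∞) (fun t ↦ ((Λ t : E4 ≃L[ℝ] E4) : E4 →L[ℝ] E4)))
    (hξ : ContDiff ℝ ((⊤ : ℕ∞) : WithTop ℕ∞) ξ) {p : ℝ × E4}
    (hp : 0 < Kerr.radius a (poincareInv (Λ p.1) (E4.ofTimeSpace p.1 (ξ p.1)) p.2))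
    {n : WithTop ℕ∞} (hn : n ≤ ((⊤ : ℕ∞) : WithTop ℕ∞)) :
    ContDiffAt ℝ n
      (fun q : ℝ × E4 ↦ boostedKerrBilin (Λ q.1) (E4.ofTimeSpace q.1 (ξ q.1)) M a q.2) p := by
  have hS : ContDiff ℝ ((⊤ : ℕ∞) : WithTop ℕ∞)
      (fun q : ℝ × E4 ↦ (((Λ q.1 : E4 ≃L[ℝ] E4).symm : E4 →L[ℝ] E4))) :=
    (contDiff_lorentz_symm hΛ).comp contDiff_fst
  have hc : ContDiff ℝ ((⊤ : ℕ∞) : WithTop ℕ∞) (fun q : ℝ × E4 ↦ E4.ofTimeSpace q.1 (ξ q.1)) := by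
    have e : (fun q : ℝ × E4 ↦ E4.ofTimeSpace q.1 (ξ q.1)) =
        fun q ↦ q.1 • E4.basisVector 0 + E4.spaceEmbed (ξ q.1) :=
      funext fun q ↦ E4.ofTimeSpace_eq_smul_add' _ _
    rw [e]
    exact (contDiff_fst.smul contDiff_const).add (E4.spaceEmbed.contDiff.comp (hξ.comp contDiff_fst))
  have hP : ContDiff ℝ ((⊤ : ℕ∞) : WithTop ℕ∞)
      (fun q : ℝ × E4 ↦ poincareInv (Λ q.1) (E4.ofTimeSpace q.1 (ξ q.1)) q.2) := by
    show ContDiff ℝ _ (fun q : ℝ × E4 ↦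
      (((Λ q.1 : E4 ≃L[ℝ] E4).symm : E4 →L[ℝ] E4)) (q.2 - E4.ofTimeSpace q.1 (ξ q.1)))
    exact hS.clm_apply (contDiff_snd.sub hc)
  have hK : ContDiffAt ℝ n (fun q : ℝ × E4 ↦ Kerr.bilin M a
      (poincareInv (Λ q.1) (E4.ofTimeSpace q.1 (ξ q.1)) q.2)) p :=
    ContDiffAt.comp (g := Kerr.bilin M a)
      (f := fun q : ℝ × E4 ↦ poincareInv (Λ q.1) (E4.ofTimeSpace q.1 (ξ q.1)) q.2) p
      (Kerr.contDiffAt_bilin M a hp) (hP.of_le hn).contDiffAt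
  have hB := contDiffWithinAt_bilinearComp_self (s := Set.univ) hK.contDiffWithinAt
    ((hS.of_le hn).contDiffAt.contDiffWithinAt)
  rw [contDiffWithinAt_univ] at hB
  refine hB.congr_of_eventuallyEq (Eventually.of_forall fun q ↦ ?_)
  exact firstOrder_boostedKerrBilin_eq_bilinearComp _ _ _ _ _

/-- **The time derivative of the painted summand is its lab first-variation field.** With
`S = Λ(t)⁻¹`, `D = d/ds Λ⁻¹|_t`, `A = D ∘ Λ(t)`, `ċ = d/ds (s, ξ s)|_t`, `d = −Sċ`, `y = S(z − (t, ξ t))`: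
`∂_s boostedKerrBilin (Λ s) (s, ξ s) M a z |_{s=t} = (∂_{Ay+d} g)(S·,S·) + g(AS·,S·) + g(S·,AS·)`
(`firstOrder_hasDerivAt_boostedKerrBilin_motion'`). [cite: KerrSchild1965, §2] -/
theorem firstOrder_fderiv_summand₂_time
    (hΛ : ContDiff ℝ ((⊤ : ℕ∞) : WithTop ℕ∞) (fun t ↦ ((Λ t : E4 ≃L[ℝ] E4) : E4 →L[ℝ] E4)))
    (hξ : ContDiff ℝ ((⊤ : ℕ∞) : WithTop ℕ∞) ξ) {t : ℝ} {z : E4}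
    (hz : 0 < Kerr.radius a (poincareInv (Λ t) (E4.ofTimeSpace t (ξ t)) z)) :
    fderiv ℝ (fun q : ℝ × E4 ↦ boostedKerrBilin (Λ q.1) (E4.ofTimeSpace q.1 (ξ q.1)) M a q.2)
        (t, z) (1, 0) =
      (fderiv ℝ (Kerr.bilin M a) (poincareInv (Λ t) (E4.ofTimeSpace t (ξ t)) z)
          (((deriv (fun s ↦ (((Λ s : E4 ≃L[ℝ] E4).symm : E4 →L[ℝ] E4))) t).comp
              ((Λ t : E4 ≃L[ℝ] E4) : E4 →L[ℝ] E4)) (poincareInv (Λ t) (E4.ofTimeSpace t (ξ t)) z) +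
            -((((Λ t : E4 ≃L[ℝ] E4).symm : E4 →L[ℝ] E4))
              (deriv (fun s ↦ E4.ofTimeSpace s (ξ s)) t)))).bilinearComp
          (((Λ t : E4 ≃L[ℝ] E4).symm : E4 →L[ℝ] E4)) (((Λ t : E4 ≃L[ℝ] E4).symm : E4 →L[ℝ] E4))
        + (Kerr.bilin M a (poincareInv (Λ t) (E4.ofTimeSpace t (ξ t)) z)).bilinearComp
          (((deriv (fun s ↦ (((Λ s : E4 ≃L[ℝ] E4).symm : E4 →L[ℝ] E4))) t).comp
              ((Λ t : E4 ≃L[ℝ] E4) : E4 →L[ℝ] E4)).comp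
            (((Λ t : E4 ≃L[ℝ] E4).symm : E4 →L[ℝ] E4)))
          (((Λ t : E4 ≃L[ℝ] E4).symm : E4 →L[ℝ] E4))
        + (Kerr.bilin M a (poincareInv (Λ t) (E4.ofTimeSpace t (ξ t)) z)).bilinearComp
          (((Λ t : E4 ≃L[ℝ] E4).symm : E4 →L[ℝ] E4))
          (((deriv (fun s ↦ (((Λ s : E4 ≃L[ℝ] E4).symm : E4 →L[ℝ] E4))) t).comp
              ((Λ t : E4 ≃L[ℝ] E4) : E4 →L[ℝ] E4)).comp
            (((Λ t : E4 ≃L[ℝ] E4).symm : E4 →L[ℝ] E4))) := by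
  have hd : DifferentiableAt ℝ
      (fun q : ℝ × E4 ↦ boostedKerrBilin (Λ q.1) (E4.ofTimeSpace q.1 (ξ q.1)) M a q.2) (t, z) :=
    (firstOrder_contDiffAt_summand₂ (M := M) hΛ hξ (p := (t, z)) hz (n := 1)
      (WithTop.coe_le_coe.mpr le_top)).differentiableAt one_ne_zero
  have h1 := firstOrder_hasDerivAt_curry hd
  have hSd : HasDerivAt (fun s ↦ (((Λ s : E4 ≃L[ℝ] E4).symm : E4 →L[ℝ] E4)))
      (deriv (fun s ↦ (((Λ s : E4 ≃L[ℝ] E4).symm : E4 →L[ℝ] E4))) t) t :=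
    ((contDiff_lorentz_symm hΛ).differentiable (by simp) t).hasDerivAt
  have hcd : HasDerivAt (fun s ↦ E4.ofTimeSpace s (ξ s))
      (deriv (fun s ↦ E4.ofTimeSpace s (ξ s)) t) t :=
    (firstOrder_hasDerivAt_centreEvent ((hξ.differentiable (by simp) t).hasDerivAt)).differentiableAt
      |>.hasDerivAt
  have h2 := firstOrder_hasDerivAt_boostedKerrBilin_motion' (M := M) hSd hcd hz
  exact h1.unique h2

-- the algebraic and the operator-norm instance paths on `E4 →L[ℝ] E4 →L[ℝ] ℝ` unify slowly
set_option synthInstance.maxHeartbeats 200000 in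
set_option maxHeartbeats 800000 in
/-- **The slice jets of one painted summand against its inertial continuation.** At a lab event
`x` with `x⁰ = t` and positive rest-frame radius, the painted summand
`z ↦ boostedKerrBilin (Λ(z⁰)) (z⁰, ξ(z⁰)) M a z` and the summand frozen at `t` have the same value,
`D(painted) = D(frozen) + dx⁰ ⊗ V(x)` and
`D²(painted)(v) = D²(frozen)(v) + v⁰ DV(x) + dx⁰ ⊗ DV(x)(v) + v⁰ dx⁰ ⊗ W` for some `W`, where `V` is
the lab first-variation field at time `t` (`firstOrder_sliceJet`, `firstOrder_fderiv_summand₂_time`).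
[cite: KerrSchild1965, §2] -/
theorem firstOrder_summand_sliceJet
    (hΛ : ContDiff ℝ ((⊤ : ℕ∞) : WithTop ℕ∞) (fun t ↦ ((Λ t : E4 ≃L[ℝ] E4) : E4 →L[ℝ] E4)))
    (hξ : ContDiff ℝ ((⊤ : ℕ∞) : WithTop ℕ∞) ξ) {x : E4} {t : ℝ} (hx : x 0 = t)
    (hr : 0 < Kerr.radius a (poincareInv (Λ t) (E4.ofTimeSpace t (ξ t)) x)) :
    ∃ W : E4 →L[ℝ] E4 →L[ℝ] ℝ,
    (fun z : E4 ↦ boostedKerrBilin (Λ (z 0)) (E4.ofTimeSpace (z 0) (ξ (z 0))) M a z) x =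
      boostedKerrBilin (Λ t) (E4.ofTimeSpace t (ξ t)) M a x ∧
    fderiv ℝ (fun z : E4 ↦ boostedKerrBilin (Λ (z 0)) (E4.ofTimeSpace (z 0) (ξ (z 0))) M a z) x =
      fderiv ℝ (boostedKerrBilin (Λ t) (E4.ofTimeSpace t (ξ t)) M a) x + (E4.dx 0).smulRight
        ((fun z ↦ (fderiv ℝ (Kerr.bilin M a) (poincareInv (Λ t) (E4.ofTimeSpace t (ξ t)) z)
          (((deriv (fun s ↦ (((Λ s : E4 ≃L[ℝ] E4).symm : E4 →L[ℝ] E4))) t).comp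
              ((Λ t : E4 ≃L[ℝ] E4) : E4 →L[ℝ] E4)) (poincareInv (Λ t) (E4.ofTimeSpace t (ξ t)) z) +
            -((((Λ t : E4 ≃L[ℝ] E4).symm : E4 →L[ℝ] E4))
              (deriv (fun s ↦ E4.ofTimeSpace s (ξ s)) t)))).bilinearComp
          (((Λ t : E4 ≃L[ℝ] E4).symm : E4 →L[ℝ] E4)) (((Λ t : E4 ≃L[ℝ] E4).symm : E4 →L[ℝ] E4))
        + (Kerr.bilin M a (poincareInv (Λ t) (E4.ofTimeSpace t (ξ t)) z)).bilinearComp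
          (((deriv (fun s ↦ (((Λ s : E4 ≃L[ℝ] E4).symm : E4 →L[ℝ] E4))) t).comp
              ((Λ t : E4 ≃L[ℝ] E4) : E4 →L[ℝ] E4)).comp
            (((Λ t : E4 ≃L[ℝ] E4).symm : E4 →L[ℝ] E4)))
          (((Λ t : E4 ≃L[ℝ] E4).symm : E4 →L[ℝ] E4))
        + (Kerr.bilin M a (poincareInv (Λ t) (E4.ofTimeSpace t (ξ t)) z)).bilinearComp
          (((Λ t : E4 ≃L[ℝ] E4).symm : E4 →L[ℝ] E4))
          (((deriv (fun s ↦ (((Λ s : E4 ≃L[ℝ] E4).symm : E4 →L[ℝ] E4))) t).comp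
              ((Λ t : E4 ≃L[ℝ] E4) : E4 →L[ℝ] E4)).comp
            (((Λ t : E4 ≃L[ℝ] E4).symm : E4 →L[ℝ] E4)))) x) ∧
    ∀ v, fderiv ℝ (fderiv ℝ (fun z : E4 ↦
        boostedKerrBilin (Λ (z 0)) (E4.ofTimeSpace (z 0) (ξ (z 0))) M a z)) x v =
      fderiv ℝ (fderiv ℝ (boostedKerrBilin (Λ t) (E4.ofTimeSpace t (ξ t)) M a)) x v +
        ((E4.dx 0) v • fderiv ℝ (fun z ↦ (fderiv ℝ (Kerr.bilin M a)
            (poincareInv (Λ t) (E4.ofTimeSpace t (ξ t)) z)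
          (((deriv (fun s ↦ (((Λ s : E4 ≃L[ℝ] E4).symm : E4 →L[ℝ] E4))) t).comp
              ((Λ t : E4 ≃L[ℝ] E4) : E4 →L[ℝ] E4)) (poincareInv (Λ t) (E4.ofTimeSpace t (ξ t)) z) +
            -((((Λ t : E4 ≃L[ℝ] E4).symm : E4 →L[ℝ] E4))
              (deriv (fun s ↦ E4.ofTimeSpace s (ξ s)) t)))).bilinearComp
          (((Λ t : E4 ≃L[ℝ] E4).symm : E4 →L[ℝ] E4)) (((Λ t : E4 ≃L[ℝ] E4).symm : E4 →L[ℝ] E4))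
        + (Kerr.bilin M a (poincareInv (Λ t) (E4.ofTimeSpace t (ξ t)) z)).bilinearComp
          (((deriv (fun s ↦ (((Λ s : E4 ≃L[ℝ] E4).symm : E4 →L[ℝ] E4))) t).comp
              ((Λ t : E4 ≃L[ℝ] E4) : E4 →L[ℝ] E4)).comp
            (((Λ t : E4 ≃L[ℝ] E4).symm : E4 →L[ℝ] E4)))
          (((Λ t : E4 ≃L[ℝ] E4).symm : E4 →L[ℝ] E4))
        + (Kerr.bilin M a (poincareInv (Λ t) (E4.ofTimeSpace t (ξ t)) z)).bilinearComp
          (((Λ t : E4 ≃L[ℝ] E4).symm : E4 →L[ℝ] E4))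
          (((deriv (fun s ↦ (((Λ s : E4 ≃L[ℝ] E4).symm : E4 →L[ℝ] E4))) t).comp
              ((Λ t : E4 ≃L[ℝ] E4) : E4 →L[ℝ] E4)).comp
            (((Λ t : E4 ≃L[ℝ] E4).symm : E4 →L[ℝ] E4)))) x +
          (E4.dx 0).smulRight (fderiv ℝ (fun z ↦ (fderiv ℝ (Kerr.bilin M a)
            (poincareInv (Λ t) (E4.ofTimeSpace t (ξ t)) z)
          (((deriv (fun s ↦ (((Λ s : E4 ≃L[ℝ] E4).symm : E4 →L[ℝ] E4))) t).comp
              ((Λ t : E4 ≃L[ℝ] E4) : E4 →L[ℝ] E4)) (poincareInv (Λ t) (E4.ofTimeSpace t (ξ t)) z) +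
            -((((Λ t : E4 ≃L[ℝ] E4).symm : E4 →L[ℝ] E4))
              (deriv (fun s ↦ E4.ofTimeSpace s (ξ s)) t)))).bilinearComp
          (((Λ t : E4 ≃L[ℝ] E4).symm : E4 →L[ℝ] E4)) (((Λ t : E4 ≃L[ℝ] E4).symm : E4 →L[ℝ] E4))
        + (Kerr.bilin M a (poincareInv (Λ t) (E4.ofTimeSpace t (ξ t)) z)).bilinearComp
          (((deriv (fun s ↦ (((Λ s : E4 ≃L[ℝ] E4).symm : E4 →L[ℝ] E4))) t).comp
              ((Λ t : E4 ≃L[ℝ] E4) : E4 →L[ℝ] E4)).comp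
            (((Λ t : E4 ≃L[ℝ] E4).symm : E4 →L[ℝ] E4)))
          (((Λ t : E4 ≃L[ℝ] E4).symm : E4 →L[ℝ] E4))
        + (Kerr.bilin M a (poincareInv (Λ t) (E4.ofTimeSpace t (ξ t)) z)).bilinearComp
          (((Λ t : E4 ≃L[ℝ] E4).symm : E4 →L[ℝ] E4))
          (((deriv (fun s ↦ (((Λ s : E4 ≃L[ℝ] E4).symm : E4 →L[ℝ] E4))) t).comp
              ((Λ t : E4 ≃L[ℝ] E4) : E4 →L[ℝ] E4)).comp
            (((Λ t : E4 ≃L[ℝ] E4).symm : E4 →L[ℝ] E4)))) x v) +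
          (E4.dx 0) v • (E4.dx 0).smulRight W) := by
  set Φ : ℝ × E4 → E4 →L[ℝ] E4 →L[ℝ] ℝ :=
    fun q ↦ boostedKerrBilin (Λ q.1) (E4.ofTimeSpace q.1 (ξ q.1)) M a q.2 with hΦ
  have hx' : (E4.dx 0) x = t := hx
  have hrx : 0 < Kerr.radius a (poincareInv (Λ ((t, x) : ℝ × E4).1)
      (E4.ofTimeSpace ((t, x) : ℝ × E4).1 (ξ ((t, x) : ℝ × E4).1)) ((t, x) : ℝ × E4).2) := hr
  have hΦ2 : ContDiffAt ℝ 2 Φ (t, x) :=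
    firstOrder_contDiffAt_summand₂ (M := M) hΛ hξ hrx (WithTop.coe_le_coe.mpr le_top)
  obtain ⟨h1, h2⟩ := firstOrder_sliceJet (Φ := Φ) (π := E4.dx 0) hx' hΦ2
  -- the variation field near `x`
  have hopen : IsOpen {z : E4 | 0 < Kerr.radius a (poincareInv (Λ t) (E4.ofTimeSpace t (ξ t)) z)} :=
    isOpen_lt continuous_const ((Kerr.continuous_radius a).comp (continuous_poincareInv _ _))
  have hV : (fun z ↦ fderiv ℝ Φ (t, z) (1, 0)) =ᶠ[𝓝 x] fun z ↦
      (fderiv ℝ (Kerr.bilin M a) (poincareInv (Λ t) (E4.ofTimeSpace t (ξ t)) z)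
          (((deriv (fun s ↦ (((Λ s : E4 ≃L[ℝ] E4).symm : E4 →L[ℝ] E4))) t).comp
              ((Λ t : E4 ≃L[ℝ] E4) : E4 →L[ℝ] E4)) (poincareInv (Λ t) (E4.ofTimeSpace t (ξ t)) z) +
            -((((Λ t : E4 ≃L[ℝ] E4).symm : E4 →L[ℝ] E4))
              (deriv (fun s ↦ E4.ofTimeSpace s (ξ s)) t)))).bilinearComp
          (((Λ t : E4 ≃L[ℝ] E4).symm : E4 →L[ℝ] E4)) (((Λ t : E4 ≃L[ℝ] E4).symm : E4 →L[ℝ] E4))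
        + (Kerr.bilin M a (poincareInv (Λ t) (E4.ofTimeSpace t (ξ t)) z)).bilinearComp
          (((deriv (fun s ↦ (((Λ s : E4 ≃L[ℝ] E4).symm : E4 →L[ℝ] E4))) t).comp
              ((Λ t : E4 ≃L[ℝ] E4) : E4 →L[ℝ] E4)).comp
            (((Λ t : E4 ≃L[ℝ] E4).symm : E4 →L[ℝ] E4)))
          (((Λ t : E4 ≃L[ℝ] E4).symm : E4 →L[ℝ] E4))
        + (Kerr.bilin M a (poincareInv (Λ t) (E4.ofTimeSpace t (ξ t)) z)).bilinearComp
          (((Λ t : E4 ≃L[ℝ] E4).symm : E4 →L[ℝ] E4))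
          (((deriv (fun s ↦ (((Λ s : E4 ≃L[ℝ] E4).symm : E4 →L[ℝ] E4))) t).comp
              ((Λ t : E4 ≃L[ℝ] E4) : E4 →L[ℝ] E4)).comp
            (((Λ t : E4 ≃L[ℝ] E4).symm : E4 →L[ℝ] E4))) := by
    filter_upwards [hopen.mem_nhds hr] with z hz
    exact firstOrder_fderiv_summand₂_time (M := M) hΛ hξ hz
  refine ⟨fderiv ℝ (fderiv ℝ Φ) (t, x) (1, 0) (1, 0), ?_, ?_, fun v ↦ ?_⟩
  · show Φ (x 0, x) = Φ (t, x)
    rw [hx]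
  · have hVx := hV.self_of_nhds
    dsimp only at hVx
    rw [hVx] at h1
    exact h1
  · have h2' := h2 v
    rw [hV.fderiv_eq] at h2'
    exact h2'

end Summand

-- the algebraic and the operator-norm instance paths on `E4 →L[ℝ] E4 →L[ℝ] ℝ` unify slowly
set_option synthInstance.maxHeartbeats 200000 in
set_option maxHeartbeats 1600000 in
/-- **The slice jets of the painted ansatz against its inertial continuation.** At a lab event `x`
of the slice `{x⁰ = t}` all of whose rest-frame radii (frozen at `t`) are positive, the painted ansatz
`g₀ = η + Σⱼ (boostedKerrBilin (Λⱼ(z⁰)) (z⁰, ξⱼ(z⁰)) Mⱼ aⱼ − η)` and the ansatz FROZEN at `t` have the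
same value, first derivatives differing by `dx⁰ ⊗ Σⱼ Vⱼ(x)` and second derivatives differing by
`v⁰ Σⱼ DVⱼ(x) + dx⁰ ⊗ (Σⱼ DVⱼ(x))(v) + v⁰ dx⁰ ⊗ W`, `Vⱼ` the lab first-variation fields of the holes at
time `t` (`firstOrder_summand_sliceJet`, summed). [cite: KerrSchild1965, §2] -/
theorem firstOrder_ansatz_sliceJet {N : ℕ} {M a : Fin N → ℝ} {Λ : Fin N → ℝ → lorentzGroup}
    {ξ : Fin N → ℝ → E3}
    (hsm : ∀ i, ContDiff ℝ ((⊤ : ℕ∞) : WithTop ℕ∞) (ξ i) ∧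
      ContDiff ℝ ((⊤ : ℕ∞) : WithTop ℕ∞) (fun t ↦ ((Λ i t : E4 ≃L[ℝ] E4) : E4 →L[ℝ] E4)))
    {x : E4} {t : ℝ} (hx : x 0 = t)
    (hr : ∀ j, 0 < Kerr.radius (a j) (poincareInv (Λ j t) (E4.ofTimeSpace t (ξ j t)) x)) :
    ∃ W : E4 →L[ℝ] E4 →L[ℝ] ℝ,
    (fun z : E4 ↦ Minkowski.bilin + ∑ j, (boostedKerrBilin (Λ j (z 0)) (E4.ofTimeSpace (z 0) (ξ j (z 0))) (M j) (a j) z - Minkowski.bilin)) x = (fun z : E4 ↦ Minkowski.bilin + ∑ j, (boostedKerrBilin (Λ j t) (E4.ofTimeSpace t (ξ j t)) (M j) (a j) z - Minkowski.bilin)) x ∧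
    fderiv ℝ (fun z : E4 ↦ Minkowski.bilin + ∑ j, (boostedKerrBilin (Λ j (z 0)) (E4.ofTimeSpace (z 0) (ξ j (z 0))) (M j) (a j) z - Minkowski.bilin)) x = fderiv ℝ (fun z : E4 ↦ Minkowski.bilin + ∑ j, (boostedKerrBilin (Λ j t) (E4.ofTimeSpace t (ξ j t)) (M j) (a j) z - Minkowski.bilin)) x +
      (E4.dx 0).smulRight (∑ j, (fun z : E4 ↦ (fderiv ℝ (Kerr.bilin (M j) (a j)) (poincareInv (Λ j t) (E4.ofTimeSpace t (ξ j t)) z) (((deriv (fun s ↦ (((Λ j s : E4 ≃L[ℝ] E4).symm : E4 →L[ℝ] E4))) t).comp ((Λ j t : E4 ≃L[ℝ] E4) : E4 →L[ℝ] E4)) (poincareInv (Λ j t) (E4.ofTimeSpace t (ξ j t)) z) + (-((((Λ j t : E4 ≃L[ℝ] E4).symm : E4 →L[ℝ] E4)) (deriv (fun s ↦ E4.ofTimeSpace s (ξ j s)) t))))).bilinearComp (((Λ j t : E4 ≃L[ℝ] E4).symm : E4 →L[ℝ] E4)) (((Λ j t : E4 ≃L[ℝ] E4).symm : E4 →L[ℝ]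 E4)) + (Kerr.bilin (M j) (a j) (poincareInv (Λ j t) (E4.ofTimeSpace t (ξ j t)) z)).bilinearComp (((deriv (fun s ↦ (((Λ j s : E4 ≃L[ℝ] E4).symm : E4 →L[ℝ] E4))) t).comp ((Λ j t : E4 ≃L[ℝ] E4) : E4 →L[ℝ] E4)).comp (((Λ j t : E4 ≃L[ℝ] E4).symm : E4 →L[ℝ] E4))) (((Λ j t : E4 ≃L[ℝ] E4).symm : E4 →L[ℝ] E4)) + (Kerr.bilin (M j) (a j) (poincareInv (Λ j t) (E4.ofTimeSpace t (ξ j t)) z)).bilinearComp (((Λ j t : E4 ≃L[ℝ] E4).symm : E4 →L[ℝ] E4)) (((deriv (fun s ↦ (((Λ j s : E4 ≃L[ℝ] E4).symm : E4 →L[ℝ] E4))) t).comp ((Λ j t : E4 ≃L[ℝ] E4) : E4 →L[ℝ] E4)).comp (((Λ j t : E4 ≃L[ℝ] E4).symm : E4 →L[ℝ] E4)))) x) ∧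
    ∀ v, fderiv ℝ (fderiv ℝ (fun z : E4 ↦ Minkowski.bilin + ∑ j, (boostedKerrBilin (Λ j (z 0)) (E4.ofTimeSpace (z 0) (ξ j (z 0))) (M j) (a j) z - Minkowski.bilin))) x v = fderiv ℝ (fderiv ℝ (fun z : E4 ↦ Minkowski.bilin + ∑ j, (boostedKerrBilin (Λ j t) (E4.ofTimeSpace t (ξ j t)) (M j) (a j) z - Minkowski.bilin))) x v +
      ((E4.dx 0) v • ∑ j, fderiv ℝ (fun z : E4 ↦ (fderiv ℝ (Kerr.bilin (M j) (a j)) (poincareInv (Λ j t) (E4.ofTimeSpace t (ξ j t)) z) (((deriv (fun s ↦ (((Λ j s : E4 ≃L[ℝ] E4).symm : E4 →L[ℝ] E4))) t).comp ((Λ j t : E4 ≃L[ℝ] E4) : E4 →L[ℝ] E4)) (poincareInv (Λ j t) (E4.ofTimeSpace t (ξ j t)) z) + (-((((Λ j t : E4 ≃L[ℝ] E4).symm : E4 →L[ℝ] E4)) (deriv (fun s ↦ E4.ofTimeSpace s (ξ j s)) t))))).bilinearComp (((Λ j t : E4 ≃L[ℝ] E4).symm : E4 →L[ℝ] E4)) (((Λ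 j t : E4 ≃L[ℝ] E4).symm : E4 →L[ℝ] E4)) + (Kerr.bilin (M j) (a j) (poincareInv (Λ j t) (E4.ofTimeSpace t (ξ j t)) z)).bilinearComp (((deriv (fun s ↦ (((Λ j s : E4 ≃L[ℝ] E4).symm : E4 →L[ℝ] E4))) t).comp ((Λ j t : E4 ≃L[ℝ] E4) : E4 →L[ℝ] E4)).comp (((Λ j t : E4 ≃L[ℝ] E4).symm : E4 →L[ℝ] E4))) (((Λ j t : E4 ≃L[ℝ] E4).symm : E4 →L[ℝ] E4)) + (Kerr.bilin (M j) (a j) (poincareInv (Λ j t) (E4.ofTimeSpace t (ξ j t)) z)).bilinearComp (((Λ j t : E4 ≃L[ℝ] E4).symm : E4 →L[ℝ] E4)) (((deriv (fun s ↦ (((Λ j s : E4 ≃L[ℝ] E4).symm : E4 →L[ℝ] E4))) t).comp ((Λ j t : E4 ≃L[ℝ] E4) : E4 →L[ℝ] E4)).comp (((Λ j t : E4 ≃L[ℝ] E4).symm : E4 →L[ℝ] E4)))) x +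
        (E4.dx 0).smulRight ((∑ j, fderiv ℝ (fun z : E4 ↦ (fderiv ℝ (Kerr.bilin (M j) (a j)) (poincareInv (Λ j t) (E4.ofTimeSpace t (ξ j t)) z) (((deriv (fun s ↦ (((Λ j s : E4 ≃L[ℝ] E4).symm : E4 →L[ℝ] E4))) t).comp ((Λ j t : E4 ≃L[ℝ] E4) : E4 →L[ℝ] E4)) (poincareInv (Λ j t) (E4.ofTimeSpace t (ξ j t)) z) + (-((((Λ j t : E4 ≃L[ℝ] E4).symm : E4 →L[ℝ] E4)) (deriv (fun s ↦ E4.ofTimeSpace s (ξ j s)) t))))).bilinearComp (((Λ j t : E4 ≃L[ℝ] E4).symm : E4 →L[ℝ] E4)) (((Λ j t : E4 ≃L[ℝ] E4).symm : E4 →L[ℝ] E4)) + (Kerr.bilin (M j) (a j) (poincareInv (Λ j t) (E4.ofTimeSpace t (ξ j t)) z)).bilinearComp (((deriv (fun s ↦ (((Λ j s : E4 ≃L[ℝ] E4).symm : E4 →L[ℝ] E4))) t).comp ((Λ j t : E4 ≃L[ℝ] E4) : E4 →L[ℝ] E4)).comp (((Λ j t : E4 ≃L[ℝ] E4).symm :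 E4 →L[ℝ] E4))) (((Λ j t : E4 ≃L[ℝ] E4).symm : E4 →L[ℝ] E4)) + (Kerr.bilin (M j) (a j) (poincareInv (Λ j t) (E4.ofTimeSpace t (ξ j t)) z)).bilinearComp (((Λ j t : E4 ≃L[ℝ] E4).symm : E4 →L[ℝ] E4)) (((deriv (fun s ↦ (((Λ j s : E4 ≃L[ℝ] E4).symm : E4 →L[ℝ] E4))) t).comp ((Λ j t : E4 ≃L[ℝ] E4) : E4 →L[ℝ] E4)).comp (((Λ j t : E4 ≃L[ℝ] E4).symm : E4 →L[ℝ] E4)))) x) v) +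
        (E4.dx 0) v • (E4.dx 0).smulRight W) := by
  classical
  -- per-summand data
  have hS : ∀ j, ∃ Wj : E4 →L[ℝ] E4 →L[ℝ] ℝ,
      (fun z : E4 ↦ boostedKerrBilin (Λ j (z 0)) (E4.ofTimeSpace (z 0) (ξ j (z 0))) (M j) (a j) z) x =
        boostedKerrBilin (Λ j t) (E4.ofTimeSpace t (ξ j t)) (M j) (a j) x ∧
      fderiv ℝ (fun z : E4 ↦ boostedKerrBilin (Λ j (z 0)) (E4.ofTimeSpace (z 0) (ξ j (z 0))) (M j) (a j) z) x =
        fderiv ℝ (boostedKerrBilin (Λ j t) (E4.ofTimeSpace t (ξ j t)) (M j) (a j)) x +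
          (E4.dx 0).smulRight ((fun z : E4 ↦ (fderiv ℝ (Kerr.bilin (M j) (a j)) (poincareInv (Λ j t) (E4.ofTimeSpace t (ξ j t)) z) (((deriv (fun s ↦ (((Λ j s : E4 ≃L[ℝ] E4).symm : E4 →L[ℝ] E4))) t).comp ((Λ j t : E4 ≃L[ℝ] E4) : E4 →L[ℝ] E4)) (poincareInv (Λ j t) (E4.ofTimeSpace t (ξ j t)) z) + (-((((Λ j t : E4 ≃L[ℝ] E4).symm : E4 →L[ℝ] E4)) (deriv (fun s ↦ E4.ofTimeSpace s (ξ j s)) t))))).bilinearComp (((Λ j t : E4 ≃L[ℝ] E4).symm : E4 →L[ℝ] E4)) (((Λ j t : E4 ≃L[ℝ] E4).symm : E4 →L[ℝ] E4)) + (Kerr.bilin (M j) (a j) (poincareInv (Λ j t) (E4.ofTimeSpace t (ξ j t)) z)).bilinearComp (((deriv (fun s ↦ (((Λ j s : E4 ≃L[ℝ] E4).symm : E4 →L[ℝ] E4))) t).comp ((Λ j t : E4 ≃L[ℝ] E4) : E4 →L[ℝ] E4)).comp (((Λ j t : E4 ≃L[ℝ] E4).symm : E4 →L[ℝ] E4)))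 (((Λ j t : E4 ≃L[ℝ] E4).symm : E4 →L[ℝ] E4)) + (Kerr.bilin (M j) (a j) (poincareInv (Λ j t) (E4.ofTimeSpace t (ξ j t)) z)).bilinearComp (((Λ j t : E4 ≃L[ℝ] E4).symm : E4 →L[ℝ] E4)) (((deriv (fun s ↦ (((Λ j s : E4 ≃L[ℝ] E4).symm : E4 →L[ℝ] E4))) t).comp ((Λ j t : E4 ≃L[ℝ] E4) : E4 →L[ℝ] E4)).comp (((Λ j t : E4 ≃L[ℝ] E4).symm : E4 →L[ℝ] E4)))) x) ∧
      ∀ v, fderiv ℝ (fderiv ℝ (fun z : E4 ↦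
          boostedKerrBilin (Λ j (z 0)) (E4.ofTimeSpace (z 0) (ξ j (z 0))) (M j) (a j) z)) x v =
        fderiv ℝ (fderiv ℝ (boostedKerrBilin (Λ j t) (E4.ofTimeSpace t (ξ j t)) (M j) (a j))) x v +
          ((E4.dx 0) v • fderiv ℝ (fun z : E4 ↦ (fderiv ℝ (Kerr.bilin (M j) (a j)) (poincareInv (Λ j t) (E4.ofTimeSpace t (ξ j t)) z) (((deriv (fun s ↦ (((Λ j s : E4 ≃L[ℝ] E4).symm : E4 →L[ℝ] E4))) t).comp ((Λ j t : E4 ≃L[ℝ] E4) : E4 →L[ℝ] E4)) (poincareInv (Λ j t) (E4.ofTimeSpace t (ξ j t)) z) + (-((((Λ j t : E4 ≃L[ℝ] E4).symm : E4 →L[ℝ] E4)) (deriv (fun s ↦ E4.ofTimeSpace s (ξ j s)) t))))).bilinearComp (((Λ j t : E4 ≃L[ℝ] E4).symm : E4 →L[ℝ] E4)) (((Λ j t : E4 ≃L[ℝ] E4).symm : E4 →L[ℝ] E4)) + (Kerr.bilin (M j) (a j) (poincareInv (Λ j t) (E4.ofTimeSpace t (ξ j t)) z)).bilinearComp (((deriv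 (fun s ↦ (((Λ j s : E4 ≃L[ℝ] E4).symm : E4 →L[ℝ] E4))) t).comp ((Λ j t : E4 ≃L[ℝ] E4) : E4 →L[ℝ] E4)).comp (((Λ j t : E4 ≃L[ℝ] E4).symm : E4 →L[ℝ] E4))) (((Λ j t : E4 ≃L[ℝ] E4).symm : E4 →L[ℝ] E4)) + (Kerr.bilin (M j) (a j) (poincareInv (Λ j t) (E4.ofTimeSpace t (ξ j t)) z)).bilinearComp (((Λ j t : E4 ≃L[ℝ] E4).symm : E4 →L[ℝ] E4)) (((deriv (fun s ↦ (((Λ j s : E4 ≃L[ℝ] E4).symm : E4 →L[ℝ] E4))) t).comp ((Λ j t : E4 ≃L[ℝ] E4) : E4 →L[ℝ] E4)).comp (((Λ j t : E4 ≃L[ℝ] E4).symm : E4 →L[ℝ] E4)))) x + (E4.dx 0).smulRight (fderiv ℝ (fun z : E4 ↦ (fderiv ℝ (Kerr.bilin (M j) (a j)) (poincareInv (Λ j t) (E4.ofTimeSpace t (ξ j t)) z) (((deriv (fun s ↦ (((Λ j s : E4 ≃L[ℝ] E4).symm : E4 →L[ℝ] E4))) t).comp ((Λ j t : E4 ≃L[ℝ]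 E4) : E4 →L[ℝ] E4)) (poincareInv (Λ j t) (E4.ofTimeSpace t (ξ j t)) z) + (-((((Λ j t : E4 ≃L[ℝ] E4).symm : E4 →L[ℝ] E4)) (deriv (fun s ↦ E4.ofTimeSpace s (ξ j s)) t))))).bilinearComp (((Λ j t : E4 ≃L[ℝ] E4).symm : E4 →L[ℝ] E4)) (((Λ j t : E4 ≃L[ℝ] E4).symm : E4 →L[ℝ] E4)) + (Kerr.bilin (M j) (a j) (poincareInv (Λ j t) (E4.ofTimeSpace t (ξ j t)) z)).bilinearComp (((deriv (fun s ↦ (((Λ j s : E4 ≃L[ℝ] E4).symm : E4 →L[ℝ] E4))) t).comp ((Λ j t : E4 ≃L[ℝ] E4) : E4 →L[ℝ] E4)).comp (((Λ j t : E4 ≃L[ℝ] E4).symm : E4 →L[ℝ] E4))) (((Λ j t : E4 ≃L[ℝ] E4).symm : E4 →L[ℝ] E4)) + (Kerr.bilin (M j) (a j) (poincareInv (Λ j t) (E4.ofTimeSpace t (ξ j t)) z)).bilinearComp (((Λ j t : E4 ≃L[ℝ] E4).symm : E4 →L[ℝ] E4)) (((deriv (fun s ↦ (((Λ j s : E4 ≃L[ℝ]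 E4).symm : E4 →L[ℝ] E4))) t).comp ((Λ j t : E4 ≃L[ℝ] E4) : E4 →L[ℝ] E4)).comp (((Λ j t : E4 ≃L[ℝ] E4).symm : E4 →L[ℝ] E4)))) x v) +
            (E4.dx 0) v • (E4.dx 0).smulRight Wj) := fun j ↦
    firstOrder_summand_sliceJet (M := M j) (hsm j).2 (hsm j).1 hx (hr j)
  choose Wj hWj using hS
  -- smoothness of the painted and of the frozen summands at `x`
  have hmov : ∀ j ∈ (Finset.univ : Finset (Fin N)), ContDiffAt ℝ 2
      (fun z : E4 ↦ boostedKerrBilin (Λ j (z 0)) (E4.ofTimeSpace (z 0) (ξ j (z 0))) (M j) (a j) z) x := by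
    intro j _
    have hrj : 0 < Kerr.radius (a j) (poincareInv (Λ j (x 0)) (E4.ofTimeSpace (x 0) (ξ j (x 0))) x) := by
      rw [hx]; exact hr j
    exact (contDiffAt_boostedKerrBilin_modulated (M j) (a j) (hsm j).2 (hsm j).1 hrj).of_le
      (WithTop.coe_le_coe.mpr le_top)
  have hfroz : ∀ j ∈ (Finset.univ : Finset (Fin N)), ContDiffAt ℝ 2
      (fun z : E4 ↦ boostedKerrBilin (Λ j t) (E4.ofTimeSpace t (ξ j t)) (M j) (a j) z) x := fun j _ ↦
    contDiffAt_boostedKerrBilin (Λ j t) _ (M j) (a j) (hr j)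
  obtain ⟨hm1, hm2⟩ := firstOrder_jets_const_add_sum Finset.univ (Minkowski.bilin : E4 →L[ℝ] E4 →L[ℝ] ℝ) hmov
  obtain ⟨hf1, hf2⟩ := firstOrder_jets_const_add_sum Finset.univ (Minkowski.bilin : E4 →L[ℝ] E4 →L[ℝ] ℝ) hfroz
  have hsR : ∀ (F : Type) [NormedAddCommGroup F] [NormedSpace ℝ F] (f : Fin N → F),
      (E4.dx 0).smulRight (∑ j, f j) = ∑ j, (E4.dx 0).smulRight (f j) := by
    intro F _ _ f; ext w; simp [Finset.smul_sum]
  refine ⟨∑ j, Wj j, ?_, ?_, fun v ↦ ?_⟩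
  · simp only [hx]
  · rw [hm1, hf1, hsR, ← Finset.sum_add_distrib]
    exact Finset.sum_congr rfl fun j _ ↦ (hWj j).2.1
  · rw [hm2, hf2, Finset.smul_sum, sum_apply, hsR, hsR, Finset.smul_sum,
      ← Finset.sum_add_distrib, ← Finset.sum_add_distrib, ← Finset.sum_add_distrib]
    exact Finset.sum_congr rfl fun j _ ↦ (hWj j).2.2 v

/-- **Registered one-line carrier form** (`firstOrder_modulatedJet_D5`, stub (D) of the crux item)
of `firstOrder_modulatedJet`. [folklore] -/
theorem firstOrder_modulatedJet_D5 : ∀ {E F : Type} [NormedAddCommGroup E] [NormedSpace ℝ E] [NormedAddCommGroup F] [NormedSpace ℝ F] {G V : E → F} {π : E →L[ℝ] ℝ} {x : E} {t : ℝ}, π x = t → ContDiffAt ℝ 2 G x → ContDiffAt ℝ 2 V x → (fun z ↦ G z + (π z - t) • V z) x = G x ∧ fderiv ℝ (fun z ↦ G z + (π z - t) • V z) x = fderiv ℝ G x + π.smulRight (V x) ∧ ∀ v, fderiv ℝ (fderiv ℝ (fun z ↦ G z + (π z - t) • V z)) x v = fderiv ℝ (fderiv ℝ G) x v + (π v • fderiv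 ℝ V x + π.smulRight (fderiv ℝ V x v) + π v • π.smulRight (0 : F)) :=
  fun hπ hG hV ↦ firstOrder_modulatedJet hπ hG hV

end Summit.FinalStateConjecture.FinalStateConjecture.Theorems.SublinearIsFree.Slaving

end
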